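import Mathlib
import Summits.ValiantsHypothesis.ValiantsHypothesis.Theses.ValuativeGCT
import Summits.ValiantsHypothesis.ValiantsHypothesis.Theses.GCTMult
import Summits.ValiantsHypothesis.ValiantsHypothesis.Theorems.ValuativeGCTValuativeFlipKroneckerCensus

/-!
# `GCTMult.GctKroneckerFlip` (stmt-ValiantsHypothesis-0888) implies `ValuativeGCT.ValuativeFlip`
# (stmt-ValiantsHypothesis-12624)

Line `skew-restriction-rank` for crux `ValuativeGCT.ValuativeFlip` (route-ValiantsHypothesis-ValuativeGCT), third
line lead, 2026-08-16 — piece H3a of the crux's logical position.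

## What

`valuativeFlip_of_gctKroneckerFlip`: the classical KRONECKER FLIP of route GCTMult — at every position `(n, m)` of
every quasi-polynomial window some `λ ⊢ m d` with at most `m²` parts has
`g(λ, m×d, m×d) < mult_{λ*} ℂ[Δ_m(X₀₀^{m-n} per_n)]` — implies the valuative flip of this route, with the NO-CUT
centre `U = ⊥`, `r = 0` and the same `(d, λ)`:
`dim T_⊥(λ) ≤ dim T₀(λ) ≤ g(λ, m×d, m×d) < mult_{λ*} ℂ[Δ_m(X₀₀^{m-n} per_n)]`,
where `T₀(λ)` is the valuative truncation with its valuative (vanishing-ideal) factor dropped and the middle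
inequality is `stub_truncT0_le_kronecker` (file `ValuativeGCTValuativeFlipKroneckerCensus`, BLMW 2011 Prop. 5.2.1
run on `ℂ[End W]`).

## Why it matters

Together with `valuativeFlip_iff_aboveBottom` and `gctMultFlip_of_valuativeFlip`
(file `ValuativeGCTValuativeFlipAboveBottom`) the crux is formally sandwiched between the two classical
Mulmuley–Sohoni flips of route GCTMult:
`GctKroneckerFlip (0888) ⇒ ValuativeFlip (12624) ⇔ ValuativeFlip above the bottom ⇒ (with ValuativeBound, 12625)
GctMultFlip (0887)`.  In particular the crux is AT MOST as hard as stmt-0888 and, above the bottom `m = n`, it is a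
multiplicity-obstruction statement for the padded permanent.

## Sources

* P. Bürgisser, J. M. Landsberg, L. Manivel, J. Weyman, SIAM J. Comput. 40(4) (2011) 1179–1209, §5.2
  Prop. 5.2.1 (arXiv:0907.2850 Prop. 5.1). [BLMW 2011 §5.2]
* K. Mulmuley, M. Sohoni, *Geometric complexity theory I/II*, SIAM J. Comput. 31 (2001) §4–5; 38 (2008).
  [Mulmuley–Sohoni 2001, 2008]
-/

set_option linter.dupNamespace false

namespace Summit.ValiantsHypothesis.ValiantsHypothesis.Theorems.ValuativeFlip

open scoped BigOperators Matrix
open Literature.NumberTheory.DiophantineGeometry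
open Literature.Computability.AlgebraicComplexity
open Summit.ValiantsHypothesis.ValiantsHypothesis.Theses.ValuativeGCT

noncomputable section

/-- Monotonicity of `finrank` below a homogeneous component: if `T` sits inside the degree-`D` homogeneous
component of the polynomial ring on `MatIdx m × MatIdx m` (finite-dimensional, `MvPolynomial.homogeneousSubmodule_fg`)
and `S ≤ T`, then `dim S ≤ dim T`.  Used with `T = T₀(λ)` (the untruncated census space) and `S = T_⊥(λ)`.  [folklore] -/
theorem finrank_mono_of_le_homogeneous {m D : ℕ} {S T : Submodule ℂ (MvPolynomial (MatIdx m × MatIdx m) ℂ)}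
    (hT : T ≤ MvPolynomial.homogeneousSubmodule (MatIdx m × MatIdx m) ℂ D) (hST : S ≤ T) :
    Module.finrank ℂ ↥S ≤ Module.finrank ℂ ↥T :=
  haveI : Module.Finite ℂ ↥(MvPolynomial.homogeneousSubmodule (MatIdx m × MatIdx m) ℂ D) :=
    Module.Finite.iff_fg.mpr (MvPolynomial.homogeneousSubmodule_fg _ _ _)
  haveI : Module.Finite ℂ ↥T := Submodule.finiteDimensional_of_le hT
  Submodule.finrank_mono hST

/-- **H3a — the classical Kronecker flip implies the crux.**  `GCTMult.GctKroneckerFlip`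
(stmt-ValiantsHypothesis-0888: in every window some `λ ⊢ m d` with `≤ m²` parts has
`g(λ, m×d, m×d) < mult_{λ*} ℂ[Δ_m(X₀₀^{m-n} per_n)]`) gives `ValuativeGCT.ValuativeFlip` (stmt-ValiantsHypothesis-12624)
with the no-cut centre `U = ⊥`, `r = 0` and the same `(d, λ)`: dropping the valuative factor,
`dim T_⊥(λ) ≤ dim T₀(λ) ≤ g(λ, m×d, m×d)` by `stub_truncT0_le_kronecker` (BLMW 2011 Prop. 5.2.1 on `ℂ[End W]`).
[BLMW 2011 §5.2; Mulmuley–Sohoni 2001, 2008; this line] -/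
theorem valuativeFlip_of_gctKroneckerFlip
    (h : Summit.ValiantsHypothesis.ValiantsHypothesis.Theses.GCTMult.GctKroneckerFlip) :
    Summit.ValiantsHypothesis.ValiantsHypothesis.Theses.ValuativeGCT.ValuativeFlip := by
  intro c
  obtain ⟨n₀, hn₀⟩ := h c
  refine ⟨n₀, fun n hn m _ hnm hm => ?_⟩
  obtain ⟨d, lam, hcard, hlt⟩ := hn₀ n hn m hnm hm
  refine ⟨⊥, 0, d, lam, ?_, hcard, ?_⟩
  · intro u hu
    rw [Submodule.mem_bot] at hu
    subst hu
    have h0 : (Matrix.of fun a b : Fin m => (0 : MatIdx m → ℂ) (toLex (a, b))) = 0 := by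
      ext a b
      simp
    rw [h0, Matrix.rank_zero]
  · have hT0 := stub_truncT0_le_kronecker m d lam hcard
    refine lt_of_le_of_lt ((finrank_mono_of_le_homogeneous (D := m * d) ?_ ?_).trans hT0) hlt
    · exact inf_le_left.trans inf_le_left
    · exact inf_le_inf (inf_le_inf inf_le_left le_rfl) le_rfl

end

end Summit.ValiantsHypothesis.ValiantsHypothesis.Theorems.ValuativeFlip
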